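import Summits.QuantumFields.YangMills.Theorems.UnitScaleTiltProp8ChartDoubleBarDefs
import Summits.QuantumFields.YangMills.Theorems.UnitScaleTiltProp8ChartDeriv
import HarnessLib

/-!
# Route `UnitScaleTilt`, crux K1 «MinimiserStabilityRegPr» (stmt-QuantumFields-19200), stub V2′ `stub_halvingStep` — pillar P3 (R1) re-base, RULING g26-№6 (S1b):
# **THE LINEARISED DOUBLE-BAR CHART IS THE STRAIGHT TUBE `η·Lʲ·Q_j` — NO COMB TERM** (`fderiv_chartLogFlat_zero_apply`; the first in-Lean falsifier of the re-base:
# [Balaban1985Averaging] (125) «the linear part … resembles the definition of the averaging operation Q in [2]», [Balaban1985Variational] (45) `LʲηQ_jHB = B`)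

Cell `ym3-torus` (HUMAN RULING D-0037: YM₃ on the torus is ladder rung R3, not the Clay problem), width seat `ym-ust-19936-w8` gen 0.
`--supports stmt-QuantumFields-19200 --as helper`; def-free, 0 sorry, standard axioms.

WHY.  RULING g26-№6 re-based the H-side chart of record on print's DOUBLE-bar functional `chartLogFlat η D A (j,c) = −i·log(U̿^{(j)}(e^{iηA})(c))`
(✓ `Prop8ChartDoubleBar`: `U̿ = v(c₋)⁻¹·Ū·v(c₊)`, frames `v` = eml of the centre-stair transporters over the symmetrised family `Idx P`).  The single-bar chart's
linearisation is `η·Q^{(j)}` with `Q^{(j)} = Lʲ·bondAvgIter j − dΛ_j` (✓`ChartDeriv.fderiv_chartLog_zero_apply`, `linAvg_eq_bondAvg_sub_grad_combMean`): the comb term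
`dΛ_j` is what the tent gauge of `ChartHInvBridge` had to invert and what carried the base-point leverage.  THIS FILE certifies that the frames remove it EXACTLY:
the derivative of the frame at the flat point is the comb mean (`D v(y)(1) = combMean`), of its inverse minus the comb mean, so one double-bar step linearises to
`−combMean(c₋) + linAvg + combMean(c₊) = L·bondAvg` — print's (125) — and by induction over the levels `fderiv (chartLogFlat η D) 0 Y (j,c) = η·Lʲ·(bondAvgIter j Y)(c)`,
the `Qlin` of F4's `chart47W` with NO pure-gauge summand, so that the right inverse of record is P2's `flatH` itself ((45), ✓`FlatCubeOperators`).
WHAT (def-free).  §1 at a flat point of any differentiable family `F` of `𝔸ˣ`-fields: `hasFDerivAt_coe_vframeU_flat` (`= |I|⁻¹Σ_i F′(Γ^σ_{y})`),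
`hasFDerivAt_coe_inv_vframeU_flat` (minus the same), ★`exists_hasFDerivAt_coe_dbarAvgU_flat` (`D[U̿(F·)(c)](x₀)v = L·bondAvg(F′·v)(c)`); §2 ★`exists_hasFDerivAt_coe_dbarIterU_expCfg_zero`
(level by level: `(iη)·Lⁱ·bondAvgIter i`); §3 ★★★`fderiv_chartLogFlat_zero_apply`, `differentiableAt_chartLogFlat_zero` (contrast the single bar: ✓`ChartBasePointGaugeLine.fderiv_chartLog_zero_gaugeDir_src`).
HONEST SCOPE.  First-order calculus at the flat point only; `hCd♭∕hCq♭` ((44)), (73)∕(157), the [B8] Thm 2 slice are the (S3)∕(S4) files.  NOT a claim about the stub,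
the crux, the rung or the mass gap.

References: T. Bałaban, CMP **98** (1985) 17–51 [Balaban1985Averaging] (89) p.31, (110)–(112) p.34, (122)–(125) p.36, (147) p.40; CMP **102** (1985) 277–309
[Balaban1985Variational] (20) p.281, (44)–(45) p.285; CMP **95** (1984) 17–40 [Balaban1984PropagatorsI] (1.11), (1.16)–(1.18) pp.19–20.
-/

set_option autoImplicit false

noncomputable section

open scoped BigOperators Matrix.Norms.L2Operator
open NormedSpace

namespace Summit.QuantumFields.YangMills.Theorems.Prop8ChartDoubleBar

open Literature.MathematicalPhysics.QuantumFieldTheory.Balaban1983to89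
open T4Continuum BlockAveraging ExpMeanLog MatrixLog BlockAveragingEMLLinearised LatticeFieldCalculus
open B7TransferAnalyticMean (meanCLM meanCLM_apply hasFDerivAt_mlog_one)
open BlockAveragingEMLAnalyticMean (hasFDerivAt_eml_one)
open B10Eq27TorusAxialLog (holT holT_nil holT_one gaugeActT gaugeActT_apply)
open B6SectADomainsV1 (Domains)
open B6SectAOperatorsV1 (BondIdx)
open Summit.QuantumFields.YangMills.Theorems.Prop8Chart
  (expCfg expCfg_zero emlAvgU emlAvgU_one hasFDerivAt_coe_holT_flat hasFDerivAt_coe_emlAvgU_flat walkSum_apply hasFDerivAt_coe_expCfg_zero)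

variable {P : Params} {j : ℕ}

/-! ## §1 One double-bar step of a differentiable family at a flat point -/

section Flat

variable {𝔸 : Type*} [NormedRing 𝔸] [NormedAlgebra ℂ 𝔸] [CompleteSpace 𝔸]
variable {E : Type*} [NormedAddCommGroup E] [NormedSpace ℂ E]

/-- **THE DERIVATIVE OF THE BLOCK FRAME AT A FLAT POINT IS THE COMB MEAN OF THE BOND DERIVATIVES**: `D[v(F·)(y)](x₀) = |I|⁻¹ Σ_i F′(Γ^{σ_i}_{y→x_i})`
(`D eml(1)` = mean, transports by ✓`hasFDerivAt_coe_holT_flat`). [cite: Balaban1985Averaging, (110)-(112) p.34] -/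
theorem hasFDerivAt_coe_vframeU_flat {F : E → GaugeField P j 𝔸ˣ} {x₀ : E} {F' : PBond P j → (E →L[ℂ] 𝔸)}
    (hF : ∀ b : PBond P j, HasFDerivAt (fun x => ((F x b : 𝔸ˣ) : 𝔸)) (F' b) x₀) (h1 : ∀ b, F x₀ b = 1) (y : Site P (j + 1)) :
    HasFDerivAt (fun x => ((vframeU (F x) y : 𝔸ˣ) : 𝔸))
      (((Fintype.card (Idx P) : ℂ))⁻¹ • ∑ i : Idx P, walkSum F' (walk (emb y) (stairWord i.2.1 (off i.1)))) x₀ := by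
  have hflat : F x₀ = fun _ => 1 := funext h1
  have hfun : (fun x => ((vframeU (F x) y : 𝔸ˣ) : 𝔸)) =
      fun x => eml (fun i : Idx P => ((holT (F x) (emb y) (stairWord i.2.1 (off i.1)) : 𝔸ˣ) : 𝔸)) := by
    funext x; exact coe_vframeU (F x) y
  rw [hfun]
  have hstairs : HasFDerivAt (fun x => fun i : Idx P => ((holT (F x) (emb y) (stairWord i.2.1 (off i.1)) : 𝔸ˣ) : 𝔸))
      (ContinuousLinearMap.pi fun i : Idx P => walkSum F' (walk (emb y) (stairWord i.2.1 (off i.1)))) x₀ :=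
    hasFDerivAt_pi.mpr fun i => hasFDerivAt_coe_holT_flat hF h1 _ _
  have h1' : (fun i : Idx P => ((holT (F x₀) (emb y) (stairWord i.2.1 (off i.1)) : 𝔸ˣ) : 𝔸)) = 1 := by
    funext i; rw [hflat, holT_one, Units.val_one, Pi.one_apply]
  have heml : HasFDerivAt (eml : (Idx P → 𝔸) → 𝔸) (meanCLM (Idx P) 𝔸)
      (fun i : Idx P => ((holT (F x₀) (emb y) (stairWord i.2.1 (off i.1)) : 𝔸ˣ) : 𝔸)) := by
    rw [h1']; exact hasFDerivAt_eml_one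
  refine (heml.comp x₀ hstairs).congr_fderiv ?_
  ext v
  simp only [ContinuousLinearMap.comp_apply, meanCLM_apply, ContinuousLinearMap.pi_apply, smul_apply, sum_apply]

/-- **… AND OF ITS INVERSE, MINUS THE COMB MEAN** (`D(u ↦ u⁻¹)(1) = −id`). [cite: Balaban1985Averaging, (110)-(112) p.34, (89) p.31] -/
theorem hasFDerivAt_coe_inv_vframeU_flat {F : E → GaugeField P j 𝔸ˣ} {x₀ : E} {F' : PBond P j → (E →L[ℂ] 𝔸)}
    (hF : ∀ b : PBond P j, HasFDerivAt (fun x => ((F x b : 𝔸ˣ) : 𝔸)) (F' b) x₀) (h1 : ∀ b, F x₀ b = 1) (y : Site P (j + 1)) :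
    HasFDerivAt (fun x => (((vframeU (F x) y)⁻¹ : 𝔸ˣ) : 𝔸))
      (-(((Fintype.card (Idx P) : ℂ))⁻¹ • ∑ i : Idx P, walkSum F' (walk (emb y) (stairWord i.2.1 (off i.1))))) x₀ := by
  have hflat : F x₀ = fun _ => 1 := funext h1
  have hv := hasFDerivAt_coe_vframeU_flat hF h1 y
  have hfun : (fun x => (((vframeU (F x) y)⁻¹ : 𝔸ˣ) : 𝔸)) = Ring.inverse ∘ fun x => ((vframeU (F x) y : 𝔸ˣ) : 𝔸) := by
    funext x; rw [Function.comp_apply, Ring.inverse_unit]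
  rw [hfun]
  have h1v : vframeU (F x₀) y = 1 := by rw [hflat, vframeU_one]
  refine ((hasFDerivAt_ringInverse (𝕜 := ℂ) (vframeU (F x₀) y)).comp x₀ hv).congr_fderiv ?_
  ext v
  simp only [ContinuousLinearMap.comp_apply, neg_apply, h1v, inv_one, Units.val_one,
    ContinuousLinearMap.mulLeftRight_apply, one_mul, mul_one]

end Flat

section FlatMatrix

variable {n : Type*} [Fintype n] [DecidableEq n]
variable {E : Type*} [NormedAddCommGroup E] [NormedSpace ℂ E]

omit [Fintype n] [DecidableEq n] in
/-- ℂ-scalars pass through the (real-weighted) straight bond average. [cite: Balaban1984PropagatorsI, (1.11) p.19] -/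
theorem bondAvg_const_smul (a : ℂ) (A : PBond P j → Matrix n n ℂ) (c : PBond P (j + 1)) :
    bondAvg (fun b => a • A b) c = a • bondAvg A c := by
  simp only [bondAvg, segSum, ← Finset.smul_sum, smul_comm a]

/-- ★ **ONE DOUBLE-BAR STEP LINEARISES TO THE STRAIGHT TUBE** — [Balaban1985Averaging] (125) at `V₀ = 1`: with `F`, `F′`, `x₀` as in `hasFDerivAt_coe_holT_flat`
(matrix algebra `M_n(ℂ)`), `x ↦ U̿(F x)(c)` has a derivative `D` at `x₀` with `D v = L·(bondAvg (F′· v))(c)` for every `v` — the comb means of the single-bar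
linearisation (✓`linAvg_eq_bondAvg_sub_grad_combMean`) are cancelled EXACTLY by the frames. [cite: Balaban1985Averaging, (122)-(125) p.36, (89) p.31] -/
theorem exists_hasFDerivAt_coe_dbarAvgU_flat {F : E → GaugeField P j (Matrix n n ℂ)ˣ} {x₀ : E} {F' : PBond P j → (E →L[ℂ] Matrix n n ℂ)}
    (hF : ∀ b : PBond P j, HasFDerivAt (fun x => ((F x b : (Matrix n n ℂ)ˣ) : Matrix n n ℂ)) (F' b) x₀) (h1 : ∀ b, F x₀ b = 1) (c : PBond P (j + 1)) :
    ∃ D : E →L[ℂ] Matrix n n ℂ, HasFDerivAt (fun x => ((dbarAvgU (F x) c : (Matrix n n ℂ)ˣ) : Matrix n n ℂ)) D x₀ ∧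
      ∀ v : E, D v = ((P.L : ℕ) : ℂ) • bondAvg (fun b => F' b v) c := by
  have hflat : F x₀ = fun _ => 1 := funext h1
  have hA := hasFDerivAt_coe_inv_vframeU_flat hF h1 c.src
  have hB := hasFDerivAt_coe_emlAvgU_flat hF h1 c
  have hC := hasFDerivAt_coe_vframeU_flat hF h1 c.tgt
  have hfun : (fun x => ((dbarAvgU (F x) c : (Matrix n n ℂ)ˣ) : Matrix n n ℂ)) =
      ((fun x => (((vframeU (F x) c.src)⁻¹ : (Matrix n n ℂ)ˣ) : Matrix n n ℂ)) * fun x => ((emlAvgU (F x) c : (Matrix n n ℂ)ˣ) : Matrix n n ℂ)) *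
        fun x => ((vframeU (F x) c.tgt : (Matrix n n ℂ)ˣ) : Matrix n n ℂ) := by
    funext x; simp only [Pi.mul_apply]; exact coe_dbarAvgU (F x) c
  rw [hfun]
  refine ⟨_, (hA.mul' hB).mul' hC, fun v => ?_⟩
  have h1A : (((vframeU (F x₀) c.src)⁻¹ : (Matrix n n ℂ)ˣ) : Matrix n n ℂ) = 1 := by rw [hflat, vframeU_one, inv_one, Units.val_one]
  have h1B : ((emlAvgU (F x₀) c : (Matrix n n ℂ)ˣ) : Matrix n n ℂ) = 1 := by rw [hflat, emlAvgU_one, Units.val_one]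
  have h1C : ((vframeU (F x₀) c.tgt : (Matrix n n ℂ)ˣ) : Matrix n n ℂ) = 1 := by rw [hflat, vframeU_one, Units.val_one]
  simp only [add_apply, smul_apply, Pi.mul_apply, h1A, h1B, h1C, one_smul, mul_one,
    MulOpposite.op_one, neg_apply, sum_apply, sub_apply, walkSum_apply]
  rw [← linAvg_def (fun b => F' b v) c, ← combMean_def (fun b => F' b v) c.tgt, ← combMean_def (fun b => F' b v) c.src,
    linAvg_eq_bondAvg_sub_grad_combMean]
  abel

/-! ## §2 Level by level at `A = 0` -/

/-- ★ **LEVEL BY LEVEL: `D[U̿^{(i)}(e^{iηA})(c)](0)·Y = (iη)·Lⁱ·(bondAvgIter i Y)(c)`** — the straight `i`-fold tube average of [Balaban1984PropagatorsI] (1.18), with NO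
coarse pure gauge (induction over the levels with §1; at `A = 0` every double-bar iterate is the flat field). [cite: Balaban1985Averaging, (125)-(127) p.36, (147) p.40;
Balaban1984PropagatorsI, (1.16)-(1.18) pp.19-20] -/
theorem exists_hasFDerivAt_coe_dbarIterU_expCfg_zero (η : ℝ) :
    ∀ (i : ℕ) (c : PBond P i), ∃ D : (PBond P 0 → Matrix n n ℂ) →L[ℂ] Matrix n n ℂ,
      HasFDerivAt (fun A : PBond P 0 → Matrix n n ℂ => ((dbarIterU i (expCfg η A) c : (Matrix n n ℂ)ˣ) : Matrix n n ℂ)) D 0 ∧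
        ∀ Y, D Y = (Complex.I * (η : ℂ)) • ((((P.L : ℕ) : ℂ) ^ i) • bondAvgIter i Y c) := by
  intro i
  induction i with
  | zero =>
    intro b
    refine ⟨(Complex.I * (η : ℂ)) • ContinuousLinearMap.proj (R := ℂ) (φ := fun _ : PBond P 0 => Matrix n n ℂ) b, ?_, fun Y => ?_⟩
    · simpa only [dbarIterU_zero] using hasFDerivAt_coe_expCfg_zero (P := P) (𝔸 := Matrix n n ℂ) η b
    · simp [bondAvgIter]
  | succ i ih =>
    intro c
    choose D hD hDQ using ih
    have h1 : ∀ b : PBond P i, dbarIterU i (expCfg η (0 : PBond P 0 → Matrix n n ℂ)) b = 1 := fun b => by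
      rw [expCfg_zero, dbarIterU_one]
    obtain ⟨D', hD', hD'Q⟩ := exists_hasFDerivAt_coe_dbarAvgU_flat
      (F := fun A : PBond P 0 → Matrix n n ℂ => dbarIterU i (expCfg η A)) (F' := D) hD h1 c
    refine ⟨D', by simpa only [dbarIterU_succ] using hD', fun Y => ?_⟩
    rw [hD'Q]
    simp only [hDQ]
    rw [bondAvg_const_smul, bondAvg_const_smul]
    show _ = (Complex.I * (η : ℂ)) • ((((P.L : ℕ) : ℂ) ^ (i + 1)) • bondAvg (bondAvgIter i Y) c)
    simp only [smul_smul]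
    congr 1
    ring

/-! ## §3 The linearised double-bar chart -/

/-- ★★★ **THE LINEARISED DOUBLE-BAR CHART IS PRINT'S `LʲηQ_j` — NO COMB GRADIENT**: for every nested family `D`, every `η` and every index `(j,c) ∈ BondIdx D`,
`fderiv ℂ (chartLogFlat η D) 0 Y (j,c) = (η·Lʲ)·(bondAvgIter j Y)(c)` (`D log(1) = id`, `(−i)(iη) = η`).  Contrast the single-bar chart: `η·Q^{(j)}` with
`Q^{(j)} = Lʲ·bondAvgIter j − dΛ_j` (✓`ChartDeriv.fderiv_chartLog_zero_apply` ∘ p522364).  This is the `Qlin` of F4's `chart47W` for the re-based chart; its right inverse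
of record is P2's `flatH` ((45) `Qlin ∘ flatH = id`, ✓`FlatCubeOperators`). [cite: Balaban1985Variational, (20) p.281, (45) p.285; Balaban1985Averaging, (125) p.36, (134) p.38] -/
theorem fderiv_chartLogFlat_zero_apply (η : ℝ) (D : Domains P) (Y : PBond P 0 → Matrix n n ℂ) (idx : BondIdx D) :
    fderiv ℂ (chartLogFlat η D : (PBond P 0 → Matrix n n ℂ) → BondIdx D → Matrix n n ℂ) 0 Y idx =
      ((η : ℂ) * ((P.L : ℕ) : ℂ) ^ (idx.1.1 : ℕ)) • bondAvgIter (idx.1.1 : ℕ) Y idx.1.2 := by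
  choose Dm hDm hDmQ using fun idx : BondIdx D => exists_hasFDerivAt_coe_dbarIterU_expCfg_zero (P := P) (n := n) η idx.1.1 idx.1.2
  have hidx : ∀ idx : BondIdx D, HasFDerivAt (fun A : PBond P 0 → Matrix n n ℂ => chartLogFlat η D A idx)
      ((-Complex.I) • ((1 : Matrix n n ℂ →L[ℂ] Matrix n n ℂ).comp (Dm idx))) 0 := by
    intro idx
    have hval : ((dbarIterU (idx.1.1 : ℕ) (expCfg η (0 : PBond P 0 → Matrix n n ℂ)) idx.1.2 : (Matrix n n ℂ)ˣ) : Matrix n n ℂ) = 1 := by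
      rw [expCfg_zero, dbarIterU_one, Units.val_one]
    have hlog : HasFDerivAt (mlog : Matrix n n ℂ → Matrix n n ℂ) (1 : Matrix n n ℂ →L[ℂ] Matrix n n ℂ)
        (((dbarIterU (idx.1.1 : ℕ) (expCfg η (0 : PBond P 0 → Matrix n n ℂ))) idx.1.2 : (Matrix n n ℂ)ˣ) : Matrix n n ℂ) := by
      rw [hval]; exact hasFDerivAt_mlog_one
    exact ((hlog.comp (0 : PBond P 0 → Matrix n n ℂ) (hDm idx)).const_smul (-Complex.I))
  have hpi : HasFDerivAt (chartLogFlat η D : (PBond P 0 → Matrix n n ℂ) → BondIdx D → Matrix n n ℂ)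
      (ContinuousLinearMap.pi fun idx : BondIdx D => (-Complex.I) • ((1 : Matrix n n ℂ →L[ℂ] Matrix n n ℂ).comp (Dm idx))) 0 :=
    hasFDerivAt_pi.mpr hidx
  rw [hpi.fderiv, ContinuousLinearMap.pi_apply, smul_apply, ContinuousLinearMap.comp_apply,
    one_apply_eq_self, hDmQ, smul_smul, smul_smul]
  congr 1
  rw [← mul_assoc, show -Complex.I * Complex.I = 1 by rw [neg_mul, Complex.I_mul_I, neg_neg], one_mul]

/-- The double-bar chart is differentiable at the flat point. [cite: Balaban1985Variational, (20) p.281; Balaban1985Averaging, Prop. 4 p.38] -/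
theorem differentiableAt_chartLogFlat_zero (η : ℝ) (D : Domains P) :
    DifferentiableAt ℂ (chartLogFlat η D : (PBond P 0 → Matrix n n ℂ) → BondIdx D → Matrix n n ℂ) 0 := by
  choose Dm hDm _hDmQ using fun idx : BondIdx D => exists_hasFDerivAt_coe_dbarIterU_expCfg_zero (P := P) (n := n) η idx.1.1 idx.1.2
  refine differentiableAt_pi.mpr fun idx => ?_
  have hval : ((dbarIterU (idx.1.1 : ℕ) (expCfg η (0 : PBond P 0 → Matrix n n ℂ)) idx.1.2 : (Matrix n n ℂ)ˣ) : Matrix n n ℂ) = 1 := by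
    rw [expCfg_zero, dbarIterU_one, Units.val_one]
  have hlog : HasFDerivAt (mlog : Matrix n n ℂ → Matrix n n ℂ) (1 : Matrix n n ℂ →L[ℂ] Matrix n n ℂ)
      (((dbarIterU (idx.1.1 : ℕ) (expCfg η (0 : PBond P 0 → Matrix n n ℂ))) idx.1.2 : (Matrix n n ℂ)ˣ) : Matrix n n ℂ) := by
    rw [hval]; exact hasFDerivAt_mlog_one
  exact ((hlog.comp (0 : PBond P 0 → Matrix n n ℂ) (hDm idx)).const_smul (-Complex.I)).differentiableAt

end FlatMatrix

end Summit.QuantumFields.YangMills.Theorems.Prop8ChartDoubleBar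

end
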